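import Literature.Computability.QuantumComplexity.ReversibleSimulation
import Literature.Computability.Cryptography.QuantumCircuitTokens
import HarnessLib

/-!
# Token streams of the `BPP ⊆ BQP` simulation circuits

Pure bookkeeping towards the uniformity of the simulation family `simCircuit`
(`ReversibleSimulation.lean`; the named fact `simFamily_isUniform`): the description
`QCircuit.sigmaEncode ⟨n, m, C⟩` of a circuit is rendered from the token stream `descTok n m C`
(`QuantumCircuitTokens.lean`, `render_descTok`), and for the circuits at hand — a Hadamard
layer followed by the Clifford+T compilation `revCompile (toRevList L _)` of a
`NOT`/`CNOT`/Toffoli program `L` (`ReversibleCliffordT.lean`, `RevGadgets.lean`) — this stream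
is an explicit function of the *numbers* of the wires of `L`:

* `opTokN : ClOp ℕ → List Tok` — the tokens of the Clifford+T word of one reversible
  operation on numbered wires (`X = HSSH`, `CNOT`, Toffoli `= H · CCZ · H` with the 7 `T`,
  6 `CNOT` word `cczWord`; the `circTok`-level counterpart of `RevDesc.opToks` of
  `RevTableauUniform.lean`, see the docstring of `opTokN`), and
  `circTok_revCompile_toRevList : circTok ⟨revCompile (toRevList L _)⟩ =
    L.flatMap fun op => opTokN (op.map Fin.val)`; for the simulation circuit,
  `circTok_simCircuit : circTok (simCircuit M tb pc n) = (progIdx …).flatMap (opTokN ∘ map num)`;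
* `flatMap_gateTok_hadamardLayer` — the Hadamard layer contributes
  `(range P).flatMap fun j => gate1Tok 0 (n + j)`;
* the numbers of the structured wires of the simulation program `progIdx M n P T` under the
  numbering `eIdx` (`num_*`: input `i ↦ i`, coin `j ↦ n + j`, wire `0`, block wires and
  ancillas of the tableau as affine functions of the step, the cell and the pattern number;
  `cellN` for the cells of block `0`);
* `ℕ`-level forms of the initialisation predicates (`notPredN`, `initSrcN`) with their values
  on the five segments of the input stack (doubled input bits `j < 2n`, the separator cells
  `2n`, `2n + 1`, the coins `2n + 2 ≤ j < Nw`, the empty cells `Nw ≤ j`), the initialisation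
  streams as iterated concatenations over stacks, cell numbers and codes
  (`flatMap_initNots`, `flatMap_initCnots`), and list algebra (`finRange` versus `range`,
  filters as conditional concatenations, splitting ranges) used to match the stream against a
  counter program (`SimUniformity.lean`).

Arora–Barak 2009, §6.1 (descriptions of circuits: gate type and wire indices in binary),
Thm. 6.6 with Remark 6.7 (the tableau circuit is logspace/polynomial-time constructible).

## References

* S. Arora, B. Barak, *Computational Complexity: A Modern Approach*, CUP 2009, §6.1–6.2,
  Thm. 6.6, Remark 6.7, Def. 6.12, Thm. 6.13.
* E. Bernstein, U. Vazirani, *Quantum complexity theory*, SIAM J. Comput. 26 (1997),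
  Thm. 8.3 (proof).
-/

noncomputable section

namespace Literature.Computability.QuantumComplexity

open _root_.Computability Complexity Cryptography

attribute [local instance] Turing.FinTM2.kFin Turing.FinTM2.ΛFin Turing.FinTM2.σFin

namespace BPPSim

/-! ### List algebra -/

section Lists

variable {α β γ : Type}

/-- A `flatMap` over `finRange` of a function of the value is a `flatMap` over `range`.
[folklore] -/
theorem finRange_flatMap_val (P : ℕ) (f : ℕ → List α) :
    ((List.finRange P).flatMap fun j : Fin P => f (j : ℕ)) = (List.range P).flatMap f := by
  rw [← List.map_coe_finRange_eq_range, List.flatMap_map]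

/-- A `map` over `finRange` of a function of the value is a `map` over `range`. [folklore] -/
theorem finRange_map_val (P : ℕ) (f : ℕ → α) :
    ((List.finRange P).map fun j : Fin P => f (j : ℕ)) = (List.range P).map f := by
  rw [← List.map_coe_finRange_eq_range, List.map_map]; rfl

/-- Mapping then flat-mapping a filtered list is a conditional flat-map. [folklore] -/
theorem flatMap_map_filter (l : List α) (p : α → Bool) (f : α → β) (g : β → List γ) :
    ((l.filter p).map f).flatMap g = l.flatMap fun a => if p a then g (f a) else [] := by
  induction l with
  | nil => rfl
  | cons a l ih =>
    rw [List.filter_cons, List.flatMap_cons, ← ih]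
    cases p a <;> simp

/-- Flat-mapping a `filterMap` is a flat-map of the optional images. [folklore] -/
theorem flatMap_filterMap (l : List α) (h : α → Option β) (g : β → List γ) :
    (l.filterMap h).flatMap g = l.flatMap fun a => ((h a).map g).getD [] := by
  induction l with
  | nil => rfl
  | cons a l ih =>
    rw [List.filterMap_cons, List.flatMap_cons, ← ih]
    cases h a <;> simp

/-- Splitting a range. [folklore] -/
theorem range_add_flatMap (a b : ℕ) (f : ℕ → List α) :
    (List.range (a + b)).flatMap f =
      (List.range a).flatMap f ++ (List.range b).flatMap fun i => f (a + i) := by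
  rw [List.range_add, List.flatMap_append, List.flatMap_map]

/-- Regrouping a range of even length in pairs. [folklore] -/
theorem range_two_mul_flatMap (n : ℕ) (f : ℕ → List α) :
    (List.range (2 * n)).flatMap f = (List.range n).flatMap fun i => f (2 * i) ++ f (2 * i + 1) := by
  induction n with
  | zero => rfl
  | succ n ih =>
    rw [show 2 * (n + 1) = 2 * n + 1 + 1 by ring, List.range_succ, List.range_succ,
      List.flatMap_append, List.flatMap_append, ih, List.range_succ, List.flatMap_append]
    all_goals simp [List.append_assoc]

/-- A `flatMap` of a constant function over a range is an iterated concatenation.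
[folklore] -/
theorem range_flatMap_const (n : ℕ) (l : List α) :
    ((List.range n).flatMap fun _ => l) = (List.replicate n l).flatten := by
  induction n with
  | zero => rfl
  | succ n ih => rw [List.range_succ, List.flatMap_append, ih, List.replicate_succ']; simp

/-- Congruence of `flatMap` over a range. [folklore] -/
theorem range_flatMap_congr {n : ℕ} {f g : ℕ → List α} (h : ∀ i < n, f i = g i) :
    (List.range n).flatMap f = (List.range n).flatMap g :=
  List.flatMap_congr fun i hi => h i (List.mem_range.1 hi)

end Lists

/-! ### Tokens of compiled reversible operations -/

/-- Tokens of a one-wire Clifford+T gate with symbol code `s` (`H = 0`, `S = 1`, `T = 2`) on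
wire `w`: tag `0 0`, symbol, separator, arity `1` quadrupled, separator, the wire, separator,
closing `0 1`. [cite: AroraBarakCC2009, §6.1] -/
def gate1Tok (s w : ℕ) : List Tok :=
  lits [false, false] ++ unaryTok s true ++ sep2 ++ lits (List.replicate 4 true) ++ sep2 ++
    (unaryTok w true ++ sep2) ++ lits [false, true]

/-- Tokens of a `CNOT` (symbol code `3`, arity `2`) with control `i` and target `j`.
[cite: AroraBarakCC2009, §6.1] -/
def cnotTok (i j : ℕ) : List Tok :=
  lits [false, false] ++ unaryTok 3 true ++ sep2 ++ lits (List.replicate 8 true) ++ sep2 ++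
    (unaryTok i true ++ sep2 ++ (unaryTok j true ++ sep2)) ++ lits [false, true]

/-- Tokens of the doubly-controlled-`Z` word `cczWord a b c` (7 `T`, 6 `CNOT`, with `T†`
spelled `S S S T`). [Nielsen–Chuang 2010, Fig. 4.9] [cite: NielsenChuang2010, §4.3 Fig. 4.9] -/
def cczTokN (a b c : ℕ) : List Tok :=
  gate1Tok 2 a ++ gate1Tok 2 b ++ gate1Tok 2 c ++
  cnotTok a b ++ gate1Tok 1 b ++ gate1Tok 1 b ++ gate1Tok 1 b ++ gate1Tok 2 b ++
  cnotTok b c ++ gate1Tok 2 c ++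
  cnotTok a c ++ gate1Tok 1 c ++ gate1Tok 1 c ++ gate1Tok 1 c ++ gate1Tok 2 c ++
  cnotTok b c ++ gate1Tok 1 c ++ gate1Tok 1 c ++ gate1Tok 1 c ++ gate1Tok 2 c ++
  cnotTok a c ++ cnotTok a b

/-- **Tokens of one reversible operation on numbered wires**: `NOT w` is `H S S H` on `w`,
`CNOT` is itself, Toffoli `a b c` is `H c · CCZ a b c · H c`. This is the `circTok`-level
counterpart (`QuantumCircuitTokens.circTok`, pinned to `revCompile` by
`circTok_revCompile_toRevList` below) of `RevDesc.opToks`/`RevDesc.agates` of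
`RevTableauUniform.lean`, which spell the same 4/1/24-gate words; the two streams differ only
in the gate-symbol field (here the unary numeral `unaryTok s true` of `gateTok`, there the
literal doubled binary numeral), and that file is not imported to keep this cone small.
[Nielsen–Chuang 2010, §4.3; Arora–Barak 2009, §6.1] [cite: NielsenChuang2010, §4.3 Fig. 4.9] -/
def opTokN : ClOp ℕ → List Tok
  | ClOp.not w => gate1Tok 0 w ++ gate1Tok 1 w ++ gate1Tok 1 w ++ gate1Tok 0 w
  | ClOp.cnot i j => cnotTok i j
  | ClOp.toffoli a b c => gate1Tok 0 c ++ cczTokN a b c ++ gate1Tok 0 c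

section Compile

variable {N : ℕ}

/-- Tokens of a placed Hadamard (symbol code `0`; the wire list of `wireEmb w` is `[w]` and
the arity `1`, by computation). [cite: AroraBarakCC2009, §6.1] -/
theorem gateTok_hOn (w : Fin N) : gateTok (hOn w) = gate1Tok 0 w := by
  show lits [false, false] ++ unaryTok 0 true ++ sep2 ++ lits (List.replicate 4 true) ++ sep2 ++
    wiresTok [(w : ℕ)] ++ lits [false, true] = _
  simp [gate1Tok, wiresTok]

/-- Tokens of a placed phase gate (symbol code `1`). [cite: AroraBarakCC2009, §6.1] -/
theorem gateTok_sOn (w : Fin N) : gateTok (sOn w) = gate1Tok 1 w := by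
  show lits [false, false] ++ unaryTok 1 true ++ sep2 ++ lits (List.replicate 4 true) ++ sep2 ++
    wiresTok [(w : ℕ)] ++ lits [false, true] = _
  simp [gate1Tok, wiresTok]

/-- Tokens of a placed `T` gate (symbol code `2`). [cite: AroraBarakCC2009, §6.1] -/
theorem gateTok_tOn (w : Fin N) : gateTok (tOn w) = gate1Tok 2 w := by
  show lits [false, false] ++ unaryTok 2 true ++ sep2 ++ lits (List.replicate 4 true) ++ sep2 ++
    wiresTok [(w : ℕ)] ++ lits [false, true] = _
  simp [gate1Tok, wiresTok]

/-- Tokens of a placed `CNOT` (symbol code `3`, arity `2`). [cite: AroraBarakCC2009, §6.1] -/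
theorem gateTok_cnotOn (i j : Fin N) (h : i ≠ j) : gateTok (cnotOn i j h) = cnotTok i j := by
  show lits [false, false] ++ unaryTok 3 true ++ sep2 ++ lits (List.replicate 8 true) ++ sep2 ++
    wiresTok [(i : ℕ), (j : ℕ)] ++ lits [false, true] = _
  simp [cnotTok, wiresTok]

/-- **Tokens of the compiled word of a reversible operation.** [cite: NielsenChuang2010, §4.3 Fig. 4.9] -/
theorem flatMap_gateTok_compile_toRev (op : ClOp (Fin N)) (h : op.WF) :
    (op.toRev h).compile.flatMap gateTok = opTokN (op.map Fin.val) := by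
  cases op with
  | not i => simp [ClOp.toRev, RevOp.compile, xWord, opTokN, ClOp.map, gateTok_hOn, gateTok_sOn]
  | cnot i j => simp [ClOp.toRev, RevOp.compile, opTokN, ClOp.map, gateTok_cnotOn]
  | toffoli a b c =>
    simp [ClOp.toRev, RevOp.compile, toffoliWord, cczWord, opTokN, cczTokN, ClOp.map,
      gateTok_hOn, gateTok_sOn, gateTok_tOn, gateTok_cnotOn]

/-- **Tokens of a compiled reversible program**: operation by operation. [cite: AroraBarakCC2009, §6.1] -/
theorem circTok_revCompile_toRevList (L : List (ClOp (Fin N))) (hL : ∀ op ∈ L, op.WF) :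
    circTok (⟨revCompile (toRevList L hL)⟩ : QCircuit cliffordT N) =
      L.flatMap fun op => opTokN (op.map Fin.val) := by
  induction L with
  | nil => rfl
  | cons op L ih =>
    rw [toRevList, revCompile_cons, circTok, List.flatMap_append, List.flatMap_cons,
      flatMap_gateTok_compile_toRev, ← ih (fun o ho => hL o (List.mem_cons_of_mem _ ho))]
    rfl

/-- Tokens of a circuit whose gate list is a concatenation. [folklore] -/
theorem circTok_mk_append {n : ℕ} (A B : List (QGate cliffordT n)) :
    circTok (⟨A ++ B⟩ : QCircuit cliffordT n) = A.flatMap gateTok ++ circTok ⟨B⟩ := by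
  simp [circTok]

/-- **Tokens of the Hadamard coin layer**: one `H` record on each wire `n + j`, `j < P`.
[cite: BernsteinVazirani1997, Thm. 8.3 (proof)] -/
theorem flatMap_gateTok_hadamardLayer (n P m : ℕ) :
    (hadamardLayer n P m).flatMap gateTok = (List.range P).flatMap fun j => gate1Tok 0 (n + j) := by
  rw [hadamardLayer, coinWires, List.map_map, List.flatMap_map,
    ← finRange_flatMap_val P fun j => gate1Tok 0 (n + j)]
  refine List.flatMap_congr fun (j : Fin P) _ => ?_
  simp [gateTok_hOn, coinWire]

/-- Composition of re-indexings: `(op.map f).map g = op.map (g ∘ f)`. A `ClOp` lemma filed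
here (next in spirit to `ClOp.target_map`, `ClOp.controls_map` of `RevGadgets.lean`, which is
already in the tree) rather than in `RevGadgets`. [folklore] -/
@[simp] theorem _root_.Literature.Computability.QuantumComplexity.ClOp.map_map {ι κ μ : Type*} (f : ι → κ) (g : κ → μ)
    (op : ClOp ι) :
    (op.map f).map g = op.map (g ∘ f) := by
  cases op <;> rfl

/-- **Tokens of a re-indexed program**: `circTok` of the compilation of `L.map (map e)` is the
stream of `opTokN` of the numbered operations. [cite: AroraBarakCC2009, §6.1] -/
theorem circTok_revCompile_map {ι : Type*} (L : List (ClOp ι)) (e : ι → Fin N)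
    (hL : ∀ op ∈ L.map (ClOp.map e), op.WF) :
    circTok (⟨revCompile (toRevList (L.map (ClOp.map e)) hL)⟩ : QCircuit cliffordT N) =
      L.flatMap fun op => opTokN (op.map fun i => (e i : ℕ)) := by
  rw [circTok_revCompile_toRevList, List.flatMap_map]
  refine List.flatMap_congr fun op _ => ?_
  simp [ClOp.map_map, Function.comp_def]

end Compile

/-! ### Numbers of the wires of the simulation program -/

section Numbering

variable (M : Turing.TM2ComputableAux Bool Bool) {n P T : ℕ}

/-- The number of a structured wire. [folklore] -/
abbrev num (x : Idx M n P T) : ℕ := (eIdx M n P T x : ℕ)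

/-- The first tableau wire. [folklore] -/
def w0 (n P : ℕ) : ℕ := n + (P + 2)

/-- Numbers of input wires. [folklore] -/
theorem num_inl (i : Fin n) : num M (Sum.inl i : Idx M n P T) = i := eIdx_inl_val M i

/-- Numbers of coin wires. [folklore] -/
theorem num_coin (j : Fin P) : num M (Sum.inr (Sum.inl j) : Idx M n P T) = n + j :=
  eIdx_inr_inl_val M j

/-- Number of wire `0`. [folklore] -/
theorem num_zeroW : num M (zeroW M n P T) = 0 := eIdx_zeroW M n P T

/-- Numbers of block wires of the tableau: label `l` of block `t`. [folklore] -/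
theorem num_tw_lab (t : Fin (T + 1)) (l : Fin (W M).nL) :
    num M (tw (Sum.inl (t, Sum.inl l)) : Idx M n P T) =
      w0 n P + ((l : ℕ) + (W M).bsize (sS M T) * t) := by
  simp only [num, eIdx_tw_val, WM.eT_inl]
  rw [WM.eB_inl, w0]; simp only [Nat.add_assoc]

/-- Numbers of block wires: state `v` of block `t`. [folklore] -/
theorem num_tw_var (t : Fin (T + 1)) (v : Fin (W M).nV) :
    num M (tw (Sum.inl (t, Sum.inr (Sum.inl v))) : Idx M n P T) =
      w0 n P + ((W M).nL + (v : ℕ) + (W M).bsize (sS M T) * t) := by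
  simp only [num, eIdx_tw_val, WM.eT_inl]
  rw [WM.eB_inr_inl, w0]; simp only [Nat.add_assoc]

/-- Numbers of block wires: cell `(k, j, g)` of block `t`. [folklore] -/
theorem num_tw_cell (t : Fin (T + 1)) (k : Fin (W M).κ) (j : Fin (sS M T)) (g : Fin (W M).A) :
    num M (tw (Sum.inl (t, (W M).cellB k j g)) : Idx M n P T) =
      w0 n P + ((W M).nL + ((W M).nV + ((g : ℕ) + (W M).A * j + sS M T * (W M).A * k)) +
        (W M).bsize (sS M T) * t) := by
  simp only [num, eIdx_tw_val, WM.eT_inl, WM.eB_cellB, w0, Nat.add_assoc]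

/-- Numbers of ancilla wires `(t, ξ, q)`. [folklore] -/
theorem num_tw_anc (t : Fin T) (ξ : (W M).Pat) (q : Fin ((W M).r + 1)) :
    num M (tw (Sum.inr (t, ξ, q)) : Idx M n P T) =
      w0 n P + ((T + 1) * (W M).bsize (sS M T) +
        ((q : ℕ) + ((W M).r + 1) * ((W M).ePat ξ : ℕ) + (W M).nPat * ((W M).r + 1) * t)) := by
  simp only [num, eIdx_tw_val, WM.eT_inr, w0, Nat.add_assoc]

/-- Number of the label wire `l` of block `0`. [folklore] -/
theorem num_blk0_lab (l : Fin (W M).nL) :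
    num M (blk0 (Sum.inl l) : Idx M n P T) = w0 n P + l := by
  rw [blk0, num_tw_lab]; simp

/-- Number of the state wire `v` of block `0`. [folklore] -/
theorem num_blk0_var (v : Fin (W M).nV) :
    num M (blk0 (Sum.inr (Sum.inl v)) : Idx M n P T) = w0 n P + ((W M).nL + v) := by
  rw [blk0, num_tw_var]; simp

/-- The number of the cell wire `(kk, j, g)` of block `0` with `S` cells per stack, as a
function of the number `j`. [folklore] -/
def cellN (n P S : ℕ) (kk : Fin (W M).κ) (j : ℕ) (g : Fin (W M).A) : ℕ :=
  w0 n P + ((W M).nL + ((W M).nV + ((g : ℕ) + (W M).A * j + S * (W M).A * kk)))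

/-- Number of the cell wire `(k, j, g)` of block `0`. [folklore] -/
theorem num_blk0_cell (k : Fin (W M).κ) (j : Fin (sS M T)) (g : Fin (W M).A) :
    num M (blk0 ((W M).cellB k j g) : Idx M n P T) = cellN M n P (sS M T) k j g := by
  rw [blk0, num_tw_cell, cellN]; simp

/-- Number of the answer wire. [folklore] -/
theorem num_ansT :
    num M (tw (ansT M T) : Idx M n P T) =
      w0 n P + ((W M).nL + ((W M).nV + ((cOut M : ℕ) + sS M T * (W M).A * (k₁' M : ℕ))) +
        (W M).bsize (sS M T) * T) := by
  rw [ansT, num_tw_cell]; simp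

/-- **Tokens of the simulation circuit**: the stream of its program on the structured wires,
numbered by `eIdx`. [cite: AroraBarakCC2009, §6.1] -/
theorem circTok_simCircuit (tb pc : ℕ → ℕ) (n : ℕ) :
    circTok (simCircuit M tb pc n) =
      (progIdx M n (pc n) (simT tb pc n)).flatMap fun op => opTokN (op.map (num M)) :=
  circTok_revCompile_map _ _ _

end Numbering

/-! ### The initialisation predicates on numbered cells -/

section Init

variable (M : Turing.TM2ComputableAux Bool Bool)

/-- `notPred` on a cell `(k, j, g)`, as a function of `[k = k₀]`, the number `j` and `g`.
[folklore] -/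
def notPredN (n P : ℕ) (isK₀ : Bool) (j : ℕ) (g : Fin (W M).A) : Bool :=
  if isK₀ then
    ((decide (j < 2 * n) || decide (j = 2 * n) || decide (2 * n + 2 ≤ j ∧ j < Nw n P)) &&
        decide (g = cB M false)) ||
      (decide (j = 2 * n + 1) && decide (g = cB M true)) ||
      (decide (Nw n P ≤ j) && decide (g = 0))
  else decide (g = 0)

/-- `notPred` on cells is `notPredN`. [folklore] -/
theorem notPred_cellB {n P T : ℕ} (k : Fin (W M).κ) (j : Fin (sS M T)) (g : Fin (W M).A) :
    notPred M n P T ((W M).cellB k j g) = notPredN M n P (decide (k = k₀' M)) j g := by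
  unfold notPred notPredN WM.cellB
  by_cases hk : k = k₀' M <;> simp [hk]

/-- The numbered source wire of the initial `CNOT` into cell `(k, j, g)`, if any: input wire
`j / 2` for the doubled bits, coin wire `n + (j - (2 n + 2))` for the coins. [folklore] -/
def initSrcN (n P : ℕ) (isK₀ : Bool) (j : ℕ) (g : Fin (W M).A) : Option ℕ :=
  if isK₀ ∧ (g = cB M true ∨ g = cB M false) then
    if j < 2 * n then some (j / 2)
    else if 2 * n + 2 ≤ j ∧ j < Nw n P then some (n + (j - (2 * n + 2))) else none
  else none

/-- The numbered source of `initSrc` on cells is `initSrcN`. [folklore] -/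
theorem initSrc_cellB_map_num {n P T : ℕ} (k : Fin (W M).κ) (j : Fin (sS M T)) (g : Fin (W M).A) :
    (initSrc M n P T ((W M).cellB k j g)).map (fun s => num M (srcW s : Idx M n P T)) =
      initSrcN M n P (decide (k = k₀' M)) j g := by
  unfold initSrc initSrcN WM.cellB
  by_cases hk : k = k₀' M
  · by_cases hg : g = cB M true ∨ g = cB M false
    · simp only [hk, hg, and_self, ↓reduceIte, decide_true]
      split_ifs with h1 h2 <;> simp [srcW, num_inl, num_coin]
    · simp [hk, hg]
  · simp [hk]

/-- `initSrc` is `none` on labels and states. [folklore] -/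
theorem initSrc_inl {n P T : ℕ} (l : Fin (W M).nL) : initSrc M n P T (Sum.inl l) = none := rfl

/-- `initSrc` is `none` on states. [folklore] -/
theorem initSrc_inr_inl {n P T : ℕ} (v : Fin (W M).nV) :
    initSrc M n P T (Sum.inr (Sum.inl v)) = none := rfl

/-! #### Segment forms of the initialisation streams on the input stack -/

variable {β : Type}

/-- On `j < 2 n`: `notPredN` holds iff `g` is the code of `false`. [folklore] -/
theorem notPredN_lt {n P j : ℕ} (hj : j < 2 * n) (g : Fin (W M).A) :
    notPredN M n P true j g = decide (g = cB M false) := by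
  unfold notPredN Nw
  have h1 : ¬ (j = 2 * n + 1) := by omega
  have h2 : ¬ (2 * n + 2 + P ≤ j) := by omega
  simp [hj, h1, h2]

/-- At `j = 2 n`: the code of `false`. [folklore] -/
theorem notPredN_2n {n P : ℕ} (g : Fin (W M).A) :
    notPredN M n P true (2 * n) g = decide (g = cB M false) := by
  unfold notPredN Nw
  have h2 : ¬ (2 * n + 2 + P ≤ 2 * n) := by omega
  simp [h2]

/-- At `j = 2 n + 1`: the code of `true`. [folklore] -/
theorem notPredN_2n1 {n P : ℕ} (g : Fin (W M).A) :
    notPredN M n P true (2 * n + 1) g = decide (g = cB M true) := by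
  unfold notPredN Nw
  have h1 : ¬ (2 * n + 1 < 2 * n) := by omega
  have h3 : ¬ (2 * n + 2 ≤ 2 * n + 1) := by omega
  have h4 : ¬ (2 * n + 2 + P ≤ 2 * n + 1) := by omega
  simp [h1, h3, h4]

/-- On the coin cells `2 n + 2 ≤ j < Nw`: the code of `false`. [folklore] -/
theorem notPredN_coin {n P i : ℕ} (hi : i < P) (g : Fin (W M).A) :
    notPredN M n P true (2 * n + 2 + i) g = decide (g = cB M false) := by
  unfold notPredN Nw
  have h1 : ¬ (2 * n + 2 + i < 2 * n) := by omega
  have h2 : ¬ (2 * n + 2 + i = 2 * n) := by omega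
  have h3 : ¬ (2 * n + 2 + i = 2 * n + 1) := by omega
  have h4 : ¬ (2 * n + 2 + P ≤ 2 * n + 2 + i) := by omega
  have h5 : 2 * n + 2 + i < 2 * n + 2 + P := by omega
  simp [h1, h2, h3, h4, h5]

/-- Beyond the input, `Nw ≤ j`: the empty code. [folklore] -/
theorem notPredN_ge {n P i : ℕ} (g : Fin (W M).A) :
    notPredN M n P true (Nw n P + i) g = decide (g = 0) := by
  unfold notPredN Nw
  have h1 : ¬ (2 * n + 2 + P + i < 2 * n) := by omega
  have h2 : ¬ (2 * n + 2 + P + i = 2 * n) := by omega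
  have h3 : ¬ (2 * n + 2 + P + i = 2 * n + 1) := by omega
  have h4 : ¬ (2 * n + 2 + P + i < 2 * n + 2 + P) := by omega
  simp [h1, h2, h3, h4]

/-- On `j < 2 n`: source `j / 2` for the two codes of a bit. [folklore] -/
theorem initSrcN_lt {n P j : ℕ} (hj : j < 2 * n) (g : Fin (W M).A) :
    initSrcN M n P true j g = if g = cB M true ∨ g = cB M false then some (j / 2) else none := by
  unfold initSrcN; simp [hj]

/-- At `j = 2 n` and `j = 2 n + 1` (the separator): no source. [folklore] -/
theorem initSrcN_sep {n P j : ℕ} (hj : j = 2 * n ∨ j = 2 * n + 1) (g : Fin (W M).A) :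
    initSrcN M n P true j g = none := by
  unfold initSrcN Nw
  have h1 : ¬ (j < 2 * n) := by omega
  have h2 : ¬ (2 * n + 2 ≤ j) := by omega
  simp [h1, h2]

/-- On the coin cells: source the coin wire `n + i`. [folklore] -/
theorem initSrcN_coin {n P i : ℕ} (hi : i < P) (g : Fin (W M).A) :
    initSrcN M n P true (2 * n + 2 + i) g =
      if g = cB M true ∨ g = cB M false then some (n + i) else none := by
  unfold initSrcN Nw
  have h1 : ¬ (2 * n + 2 + i < 2 * n) := by omega
  have h5 : 2 * n + 2 + i < 2 * n + 2 + P := by omega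
  simp [h1, h5]

/-- Beyond the input: no source. [folklore] -/
theorem initSrcN_ge {n P i : ℕ} (g : Fin (W M).A) : initSrcN M n P true (Nw n P + i) g = none := by
  unfold initSrcN Nw
  have h1 : ¬ (2 * n + 2 + P + i < 2 * n) := by omega
  have h4 : ¬ (2 * n + 2 + P + i < 2 * n + 2 + P) := by omega
  simp [h1, h4]

/-- Off the input stack: no source. [folklore] -/
theorem initSrcN_false {n P j : ℕ} (g : Fin (W M).A) : initSrcN M n P false j g = none := by
  simp [initSrcN]

/-! #### The initialisation streams on numbered wires -/

/-- **The `NOT` stream of the initialisation on numbered wires**: labels, states, then the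
cells stack by stack, cell by cell, code by code. [cite: Sipser2012, Thm. 9.30 (proof)] -/
theorem flatMap_initNots (n P T : ℕ) :
    (initNots M n P T).flatMap (fun op => opTokN (op.map (num M))) =
      ((List.finRange (W M).nL).flatMap fun l =>
        if l = TM2Bridge.eL M.tm (some M.tm.main) then opTokN (ClOp.not (w0 n P + l)) else []) ++
      ((List.finRange (W M).nV).flatMap fun v =>
        if v = TM2Bridge.eV M.tm M.tm.initialState then
          opTokN (ClOp.not (w0 n P + ((W M).nL + v))) else []) ++
      ((List.finRange (W M).κ).flatMap fun kk => (List.range (sS M T)).flatMap fun j =>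
        (List.finRange (W M).A).flatMap fun g =>
          if notPredN M n P (decide (kk = k₀' M)) j g then
            opTokN (ClOp.not (cellN M n P (sS M T) kk j g)) else []) := by
  rw [initNots, flatMap_map_filter, allB, List.flatMap_append, List.flatMap_append,
    List.flatMap_map, List.flatMap_map, List.flatMap_assoc]
  congr 1
  · congr 1
    · refine List.flatMap_congr fun l _ => ?_
      by_cases h : l = TM2Bridge.eL M.tm (some M.tm.main)
      · have e : notPred M n P T (Sum.inl l) = true := decide_eq_true h
        rw [if_pos e, if_pos h]
        show opTokN (ClOp.not (num M (blk0 (Sum.inl l) : Idx M n P T))) = _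
        rw [num_blk0_lab]
      · have e : ¬ notPred M n P T (Sum.inl l) = true := fun h' =>
          h (of_decide_eq_true (p := l = TM2Bridge.eL M.tm (some M.tm.main)) h')
        rw [if_neg e, if_neg h]
    · refine List.flatMap_congr fun v _ => ?_
      by_cases h : v = TM2Bridge.eV M.tm M.tm.initialState
      · have e : notPred M n P T (Sum.inr (Sum.inl v)) = true := decide_eq_true h
        rw [if_pos e, if_pos h]
        show opTokN (ClOp.not (num M (blk0 (Sum.inr (Sum.inl v)) : Idx M n P T))) = _
        rw [num_blk0_var]
      · have e : ¬ notPred M n P T (Sum.inr (Sum.inl v)) = true := fun h' =>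
          h (of_decide_eq_true (p := v = TM2Bridge.eV M.tm M.tm.initialState) h')
        rw [if_neg e, if_neg h]
  · refine List.flatMap_congr fun kk _ => ?_
    rw [List.flatMap_assoc, ← finRange_flatMap_val]
    refine List.flatMap_congr fun j _ => ?_
    rw [List.flatMap_map]
    refine List.flatMap_congr fun g _ => ?_
    simp only [notPred_cellB, ClOp.map, num_blk0_cell]

/-- **The `CNOT` stream of the initialisation on numbered wires.** [folklore] -/
theorem flatMap_initCnots (n P T : ℕ) :
    (initCnots M n P T).flatMap (fun op => opTokN (op.map (num M))) =
      (List.finRange (W M).κ).flatMap fun kk => (List.range (sS M T)).flatMap fun j =>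
        (List.finRange (W M).A).flatMap fun g =>
          ((initSrcN M n P (decide (kk = k₀' M)) j g).map fun s =>
            cnotTok s (cellN M n P (sS M T) kk j g)).getD [] := by
  have hA : ((List.finRange (W M).nL).flatMap fun l : Fin (W M).nL =>
      (((initSrc M n P T (Sum.inl l)).map fun s =>
        ClOp.cnot (srcW s : Idx M n P T) (blk0 (Sum.inl l))).map
          fun op => opTokN (op.map (num M))).getD []) = [] :=
    List.flatMap_eq_nil_iff.2 fun _ _ => rfl
  have hB : ((List.finRange (W M).nV).flatMap fun v : Fin (W M).nV =>
      (((initSrc M n P T (Sum.inr (Sum.inl v))).map fun s =>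
        ClOp.cnot (srcW s : Idx M n P T) (blk0 (Sum.inr (Sum.inl v)))).map
          fun op => opTokN (op.map (num M))).getD []) = [] :=
    List.flatMap_eq_nil_iff.2 fun _ _ => rfl
  rw [initCnots, flatMap_filterMap, allB, List.flatMap_append, List.flatMap_append,
    List.flatMap_map, List.flatMap_map, List.flatMap_assoc, hA, hB, List.nil_append,
    List.nil_append]
  refine List.flatMap_congr fun kk _ => ?_
  rw [List.flatMap_assoc, ← finRange_flatMap_val]
  refine List.flatMap_congr fun j _ => ?_
  rw [List.flatMap_map]
  refine List.flatMap_congr fun g _ => ?_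
  rw [← initSrc_cellB_map_num]
  generalize initSrc M n P T ((W M).cellB kk j g) = o
  cases o <;> simp [ClOp.map, opTokN, num_blk0_cell]

end Init

end BPPSim

end Literature.Computability.QuantumComplexity
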